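import Literature.NumberTheory.Rogawski1990.ArchSingularPinTopFormUniversal              -- ★ p843831 (U) text of record (`hU` binder currency)
import Literature.NumberTheory.Weil1964.UnitaryArchSingularCentralizerFramePlaces        -- ★ p844365 U3 `centralizerMeasureOfFrame_pi_eq_map_pi` + local frame map
import Literature.NumberTheory.Weil1964.UnitaryArchSingularCentralizerWallFrames         -- ★ p844161 (b5) `exists_isSingularArchFrame_archDiagTorus_wall'`
import Literature.NumberTheory.Weil1964.UnitaryArchSingularCentralizerTopFormHaarFrames  -- ★ `centralizerTopFormHaar_eq_centralizerMeasureOfFrame`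
import HarnessLib

/-!
# (U) FROM PER-PLACE TOP-FORM DATA: the universal pin ratio `K = M ^ #{complex places}` once the block top-form measures factor over the places and every
# local frame measure has mass `M` (compact places) ∕ is `M ×` the pinned transport (noncompact places)  («(U)-ROAD» brick U5, generic assembly; Rogawski 1990 §1.7, §3.8, §8.2)

Topic `NumberTheory/Rogawski1990`; namespace `Literature.NumberTheory.Rogawski1990`.  THEOREMS ONLY (no `def`, no instance, no notation, no axiom, no named fact, no `sorry`).
Cell `pub/hodgecm-mathlib`, ENGINE T1 (crux H413 = `stmt-HodgeConjecture-24833`, supports-only); the (U) road (books row «(U)»; LEAD F0P3a-plan (g10) T9-32 (4) ∕ T9-34 (2);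
MEMO «(U)-ROAD v0» F0P3-p03 (g11) 0f8ca2f389d5ab6c bricks U1–U5; (R1) review ruling on p844247: (U) is NOT a printed result — it must be PROVED; the printed input is the sign
relation `c_{H′} = −c_H` for compatible measures, §8.2 p. 118).  Count-neutral; HONEST LABEL: HC_CM is proved only modulo the printed citations until rung 0 closes; this file pays
nothing by itself — it REDUCES the universal witness-free pin ratio (U) (the `hU` binder of ★ `smul_centralizerTopFormHaar_of_universal_pinRatio`, ★ (W4f)
`exists_archSingularMembers_withData_of_universal_pinRatio`) to three PER-PLACE statements about top-form measures, in the exact currency the (U)-road bricks produce: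

* (U2, A-p06 (g28) `map_archPiEquivCM_archTopFormHaar`) the block top-form measures FACTOR over the complex places: `(archTopFormHaar H_a)⁎e = ⊗_w μ₂(H_a)_w` on
  `Π_w U(σ_w H_a)(ℂ)` (`e = archPiEquivCM`), likewise for `H_b` — read here as the hypotheses `hfac2 ∕ hfac1` for ABSTRACT per-place block measures `μ2 ∕ μ1`;
* (HC) at a COMPACT wall place `(w, σ)` (`0 < Re σ_w α_{σ⁻¹0} · Re σ_w α_{σ⁻¹2}`) the local frame measure `θ_w := (u ↦ T_w (u₁ ⊕ᶠ u₂) T_w⁻¹)⁎(μ₂(H_a)_w ⊗ μ₁(H_b)_w)` on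
  `Z(γ_w) ≤ U(diag σ_w α)(ℂ)` (★ U3's local frame map) is a Haar measure of total mass `M` — print: `vol(U(2) × U(1))` for the top-form measures [Rogawski1990 §3.8 (a), §14.5];
* (HN) at a NONCOMPACT wall place, for every `(−1)`-pinned Haar family `νH` (the `hνH ∕ hpin` binders of (U) verbatim), `θ_w = M • (relabelling transport of νH_{w,σ⁻¹})` — print:
  the limit formula [§8.2 Prop. 8.2.1–8.2.2 pp. 117–120] pins the compatible measure of `Z(γ_w) ≅ U(1,1) × U(1)` with the constant `c_{H′} = −c_H` [p. 118].

HEAD **`exists_universalPinRatio_of_localData`**: under (U2) + (HC) + (HN) with one constant `M ≠ 0`, (U) holds with `K := M ^ #{w ∣ w complex}`.  PROOF (pure bookkeeping):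
at `(z, ρ)` take a frame of `t(z∘ρ)` (★ (b5) `exists_isSingularArchFrame_archDiagTorus_wall'`); `centralizerTopFormHaar = centralizerMeasureOfFrame` (★); factor the blocks (U2);
★ U3 `centralizerMeasureOfFrame_pi_eq_map_pi` with `θ_w := M • ρZ_{w,ρ_w}` — admissible since `θ_w`'s defining identity is (HC) + Haar uniqueness with masses `M ∕ 1`
(Mathlib `isMulLeftInvariant_eq_smul`, (U)'s `hρZi ∕ hρZ1`) at compact places and (HN) + (U)'s `hρZ` at noncompact places; finally `⊗_w (M • ρZ_w) = M^{#w} • ⊗_w ρZ_w` and (U)'s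
`hρP ∕ hρ′` currency.  What remains for (U) UNCONDITIONALLY: discharge (U2) (A-p06 FILE C + product theorem), (HC) (volumes of `U(2)`, `U(1)` for `|ω_std|`), (HN) (the printed
sign relation, U4) — each a per-place statement about ONE group.

## References
* [Rogawski1990] J. D. Rogawski, *Automorphic Representations of Unitary Groups in Three Variables*, Ann. of Math. Stud. 123 (1990), §1.7 p. 6; §3.8 Prop. 3.8.1 (a) p. 27;
  §8.2 Prop. 8.2.1–8.2.2 pp. 117–120 (p. 118: `c_{H′} = −c_H`); §14.5 pp. 238–239.
* [DeitmarEchterhoff2014] A. Deitmar, S. Echterhoff, *Principles of Harmonic Analysis*, 2nd ed. (2014), Thm. 1.5.3 (product measures on product groups); §1.3 (uniqueness of Haar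
  measure up to a scalar).
* [BorelJacquet1979] A. Borel, H. Jacquet, *Automorphic forms and automorphic representations*, PSPM 33.1 (1979), §4.1 (`G(F ⊗ ℝ) = ∏_v G(F_v)`).
-/

set_option autoImplicit false

noncomputable section

open MeasureTheory Measure Filter Topology NumberField NumberField.InfinitePlace NumberField.mixedEmbedding Equiv Function Set
open Literature.MeasureTheory.Group Literature.NumberTheory.Automorphic
open Literature.NumberTheory.Automorphic.UnitaryGroup hiding hermForm
open Literature.LinearAlgebra.Matrix
open Literature.NumberTheory.Weil1964 Literature.NumberTheory.Weil1964.UnitaryArchTopForm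
open scoped Matrix MatrixGroups Matrix.Norms.Operator ContDiff NNReal ENNReal

namespace Literature.NumberTheory.Rogawski1990

/-! ## §1 Two measure-theoretic trivialities -/

/-- `μ⁎f = ν` and `g ∘ f = id` (both measurable) give `μ = ν⁎g`. [folklore] -/
private theorem eq_map_of_map_eq {X Y : Type*} [MeasurableSpace X] [MeasurableSpace Y] {f : X → Y} {g : Y → X}
    (hf : Measurable f) (hg : Measurable g) (hgf : ∀ x, g (f x) = x) {μ : Measure X} {ν : Measure Y} (h : μ.map f = ν) :
    μ = ν.map g := by
  rw [← h, Measure.map_map hg hf]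
  have hid : g ∘ f = id := funext hgf
  rw [hid, Measure.map_id]

/-- `⊗_i (c • m_i) = c ^ #ι • ⊗_i m_i` for σ-finite `m_i` and `c : ℝ≥0`. [folklore] -/
private theorem pi_const_smul {ι : Type*} [Fintype ι] {X : ι → Type*} [∀ i, MeasurableSpace (X i)] (m : ∀ i, Measure (X i))
    [∀ i, SigmaFinite (m i)] (c : ℝ≥0) :
    Measure.pi (fun i => c • m i) = (c ^ Fintype.card ι) • Measure.pi m := by
  refine Measure.pi_eq (μ := fun i => c • m i) (μ' := (c ^ Fintype.card ι) • Measure.pi m) fun s _ => ?_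
  rw [Measure.smul_apply, Measure.pi_pi]
  simp only [Measure.smul_apply, ENNReal.smul_def, smul_eq_mul, ENNReal.coe_pow]
  rw [Finset.prod_mul_distrib, Finset.prod_const, Finset.card_univ]

/-- Two Haar measures on a second countable locally compact group with total masses `M` and `1`: `μ′ = M • μ` (Haar uniqueness up to a scalar). [folklore] -/
private theorem eq_smul_of_isHaarMeasure_of_measure_univ {G : Type*} [Group G] [TopologicalSpace G] [IsTopologicalGroup G] [LocallyCompactSpace G]
    [SecondCountableTopology G] [MeasurableSpace G] [BorelSpace G] (μ' μ : Measure G) [μ.IsHaarMeasure] [μ'.IsHaarMeasure] {M : ℝ≥0}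
    (h' : μ' Set.univ = M) (h : μ Set.univ = 1) : μ' = M • μ := by
  have e := isMulLeftInvariant_eq_smul μ' μ
  rw [e] at h' ⊢
  rw [Measure.smul_apply, h, ENNReal.smul_def, smul_eq_mul, mul_one, ENNReal.coe_inj] at h'
  rw [h']

/-! ## §2 HEAD: (U) from per-place top-form data -/

variable (L : Type) [Field L] [NumberField L] [IsCMField L]

open scoped Classical in
/-- **(U) FROM PER-PLACE TOP-FORM DATA.**  Let `α` be a nondegenerate hermitian diagonal type, `z₁` the model wall point, and suppose:
(U2) the block top-form measures factor over the complex places through `archPiEquivCM` into per-place block measures `μ2 (H_a)_w`, `μ1 (H_b)_w` (`hfac2`, `hfac1`);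
(HC) at every compact relabelled wall place the local frame measure `θ_w = (u ↦ T_w (u₁ ⊕ᶠ u₂) T_w⁻¹)⁎(μ2 (H_a)_w ⊗ μ1 (H_b)_w)` of every frame of `t(z∘ρ)` is Haar of mass `M`;
(HN) at every noncompact one, for every `(−1)`-pinned Haar family `νH`, `θ_w = M •` (the relabelling transport of `νH_{w, ρ_w⁻¹}`).
Then the universal pin ratio (U) — the `hU` binder of ★ `smul_centralizerTopFormHaar_of_universal_pinRatio` ∕ ★ (W4f), verbatim — holds with `K := M ^ #{w complex}`:
`centralizerTopFormHaar (diag α) (t(z∘ρ)) = K • ρ′` for every admissible `(νH, z, ρ, ρZ, ρP, ρ′)`.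
[cite: Rogawski1990, §1.7 p. 6; §3.8 Prop. 3.8.1 (a) p. 27; §8.2 pp. 117–120; §14.5 pp. 238–239] [cite: DeitmarEchterhoff2014, Thm. 1.5.3; §1.3] [cite: BorelJacquet1979, §4.1] -/
theorem exists_universalPinRatio_of_localData [MeasurableSpace (GL (Fin 3) ℂ)] [BorelSpace (GL (Fin 3) ℂ)]
    [MeasurableSpace (GL (Fin 2) ℂ)] [BorelSpace (GL (Fin 2) ℂ)] [MeasurableSpace (GL (Fin 1) ℂ)] [BorelSpace (GL (Fin 1) ℂ)]
    (α : Fin 3 → L) (hα : ∀ i, α i ≠ 0) (hherm : ∀ i, (IsCMField.complexConj L (α i) : L) = α i)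
    [MeasurableSpace (arch (↥(maximalRealSubfield L)) L (IsCMField.complexConj L) 3 (Matrix.diagonal α))]
    [BorelSpace (arch (↥(maximalRealSubfield L)) L (IsCMField.complexConj L) 3 (Matrix.diagonal α))]
    (z₁ : {w : InfinitePlace L // IsComplex w} → Fin 3 → Circle) (h02 : ∀ w, z₁ w 0 = z₁ w 2) (h01 : ∀ w, z₁ w 0 ≠ z₁ w 1)
    [iR : ∀ (w : {w : InfinitePlace L // IsComplex w}) (τ : Perm (Fin 3)),
      MeasurableSpace (archLocal L 3 (Matrix.diagonal (α ∘ ⇑τ)) w ⧸ Subgroup.centralizer ({(⟨circleDiagonal 3 (z₁ w), circleDiagonal_mem_archLocal_diagonal L 3 (α ∘ ⇑τ) w (z₁ w)⟩ : archLocal L 3 (Matrix.diagonal (α ∘ ⇑τ)) w)} : Set (archLocal L 3 (Matrix.diagonal (α ∘ ⇑τ)) w)))]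
    [iRb : ∀ (w : {w : InfinitePlace L // IsComplex w}) (τ : Perm (Fin 3)),
      BorelSpace (archLocal L 3 (Matrix.diagonal (α ∘ ⇑τ)) w ⧸ Subgroup.centralizer ({(⟨circleDiagonal 3 (z₁ w), circleDiagonal_mem_archLocal_diagonal L 3 (α ∘ ⇑τ) w (z₁ w)⟩ : archLocal L 3 (Matrix.diagonal (α ∘ ⇑τ)) w)} : Set (archLocal L 3 (Matrix.diagonal (α ∘ ⇑τ)) w)))]
    -- (U2) per-place block measures and the factorisation of the block top-form measures
    (μ2 : ∀ (J : Matrix (Fin 2) (Fin 2) L) (w : {w : InfinitePlace L // IsComplex w}), Measure (archLocal L 2 J w)) [∀ J w, SigmaFinite (μ2 J w)]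
    (μ1 : ∀ (J : Matrix (Fin 1) (Fin 1) L) (w : {w : InfinitePlace L // IsComplex w}), Measure (archLocal L 1 J w)) [∀ J w, SigmaFinite (μ1 J w)]
    (hfac2 : ∀ (J : Matrix (Fin 2) (Fin 2) L), (J.map (IsCMField.complexConj L))ᵀ = J → IsUnit J.det →
      ∀ [MeasurableSpace (arch (↥(maximalRealSubfield L)) L (IsCMField.complexConj L) 2 J)] [BorelSpace (arch (↥(maximalRealSubfield L)) L (IsCMField.complexConj L) 2 J)]
        [MeasurableSpace (archSkew (↥(maximalRealSubfield L)) L (IsCMField.complexConj L) 2 J)] [BorelSpace (archSkew (↥(maximalRealSubfield L)) L (IsCMField.complexConj L) 2 J)],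
        (archTopFormHaar (↥(maximalRealSubfield L)) L (IsCMField.complexConj L) 2 J).map (archPiEquivCM 2 L J) = Measure.pi (μ2 J))
    (hfac1 : ∀ (J : Matrix (Fin 1) (Fin 1) L), (J.map (IsCMField.complexConj L))ᵀ = J → IsUnit J.det →
      ∀ [MeasurableSpace (arch (↥(maximalRealSubfield L)) L (IsCMField.complexConj L) 1 J)] [BorelSpace (arch (↥(maximalRealSubfield L)) L (IsCMField.complexConj L) 1 J)]
        [MeasurableSpace (archSkew (↥(maximalRealSubfield L)) L (IsCMField.complexConj L) 1 J)] [BorelSpace (archSkew (↥(maximalRealSubfield L)) L (IsCMField.complexConj L) 1 J)],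
        (archTopFormHaar (↥(maximalRealSubfield L)) L (IsCMField.complexConj L) 1 J).map (archPiEquivCM 1 L J) = Measure.pi (μ1 J))
    -- the common per-place constant
    (M : ℝ≥0) (hM : M ≠ 0)
    -- (HC) compact wall places: the local frame measure is Haar of mass `M`
    (hC : ∀ (z : {w : InfinitePlace L // IsComplex w} → Fin 3 → Circle) (hwall : ∀ w, z w 0 = z w 2 ∧ z w 0 ≠ z w 1)
        (_hrat : ∃ a b : L, ∀ w : {w : InfinitePlace L // IsComplex w}, ((z w 0 : ℂ) = w.1.embedding a) ∧ ((z w 1 : ℂ) = w.1.embedding b))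
        (ρ : {w : InfinitePlace L // IsComplex w} → Perm (Fin 3)) (w : {w : InfinitePlace L // IsComplex w}),
        0 < (w.1.embedding (α ((ρ w)⁻¹ 0))).re * (w.1.embedding (α ((ρ w)⁻¹ 2))).re →
        ∀ (a b : L) (T : GL (Fin 3) (mixedSpace L)) (H_a : Matrix (Fin 2) (Fin 2) L) (H_b : Matrix (Fin 1) (Fin 1) L)
          (hf : IsSingularArchFrame L (Matrix.diagonal α) (archDiagTorus L 3 α (fun w => z w ∘ ⇑(ρ w))) a b T H_a H_b),
          (((μ2 H_a w).prod (μ1 H_b w)).map (fun u : archLocal L 2 H_a w × archLocal L 1 H_b w =>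
            (⟨⟨Matrix.GeneralLinearGroup.map (evalC L w) T *
                ((blockDiagFin (starRingEnd ℂ) (H_a.map w.1.embedding) (H_b.map w.1.embedding) u : unitaryGroupOfForm (starRingEnd ℂ) (finSum 2 1 (H_a.map w.1.embedding) (H_b.map w.1.embedding))) : GL (Fin (2 + 1)) ℂ) *
                (Matrix.GeneralLinearGroup.map (evalC L w) T)⁻¹, conj_blockDiagFin_mem_archLocal L w (formCongr_map_evalC_of_formCongr_archFormOf L hf.formCongr_eq w) u⟩,
              conj_blockDiagFin_mem_centralizer L w (formCongr_map_evalC_of_formCongr_archFormOf L hf.formCongr_eq w) (⟨circleDiagonal 3 (z w ∘ ⇑(ρ w)), circleDiagonal_mem_archLocal_diagonal L 3 α w (z w ∘ ⇑(ρ w))⟩ : archLocal L 3 (Matrix.diagonal α) w)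
                (by rw [coe_eq_map_evalC_of_archPiEquivCM_symm_eq L (archPiEquivCM_symm_circleDiagonal_eq_archDiagTorus L 3 α (fun w => z w ∘ ⇑(ρ w))) w]; exact mul_eq_map_evalC_of_mul_eq L hf.mul_eq w) u⟩ :
              Subgroup.centralizer ({(⟨circleDiagonal 3 (z w ∘ ⇑(ρ w)), circleDiagonal_mem_archLocal_diagonal L 3 α w (z w ∘ ⇑(ρ w))⟩ : archLocal L 3 (Matrix.diagonal α) w)} : Set (archLocal L 3 (Matrix.diagonal α) w))))).IsHaarMeasure ∧
          (((μ2 H_a w).prod (μ1 H_b w)).map (fun u : archLocal L 2 H_a w × archLocal L 1 H_b w =>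
            (⟨⟨Matrix.GeneralLinearGroup.map (evalC L w) T *
                ((blockDiagFin (starRingEnd ℂ) (H_a.map w.1.embedding) (H_b.map w.1.embedding) u : unitaryGroupOfForm (starRingEnd ℂ) (finSum 2 1 (H_a.map w.1.embedding) (H_b.map w.1.embedding))) : GL (Fin (2 + 1)) ℂ) *
                (Matrix.GeneralLinearGroup.map (evalC L w) T)⁻¹, conj_blockDiagFin_mem_archLocal L w (formCongr_map_evalC_of_formCongr_archFormOf L hf.formCongr_eq w) u⟩,
              conj_blockDiagFin_mem_centralizer L w (formCongr_map_evalC_of_formCongr_archFormOf L hf.formCongr_eq w) (⟨circleDiagonal 3 (z w ∘ ⇑(ρ w)), circleDiagonal_mem_archLocal_diagonal L 3 α w (z w ∘ ⇑(ρ w))⟩ : archLocal L 3 (Matrix.diagonal α) w)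
                (by rw [coe_eq_map_evalC_of_archPiEquivCM_symm_eq L (archPiEquivCM_symm_circleDiagonal_eq_archDiagTorus L 3 α (fun w => z w ∘ ⇑(ρ w))) w]; exact mul_eq_map_evalC_of_mul_eq L hf.mul_eq w) u⟩ :
              Subgroup.centralizer ({(⟨circleDiagonal 3 (z w ∘ ⇑(ρ w)), circleDiagonal_mem_archLocal_diagonal L 3 α w (z w ∘ ⇑(ρ w))⟩ : archLocal L 3 (Matrix.diagonal α) w)} : Set (archLocal L 3 (Matrix.diagonal α) w))))) Set.univ = M)
    -- (HN) noncompact wall places: the local frame measure is `M •` the pinned transport, for every `(−1)`-pinned Haar family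
    (hN : ∀ (νH : ∀ (w : {w : InfinitePlace L // IsComplex w}) (τ : Perm (Fin 3)), Measure (Subgroup.centralizer ({(⟨circleDiagonal 3 (z₁ w), circleDiagonal_mem_archLocal_diagonal L 3 (α ∘ ⇑τ) w (z₁ w)⟩ : archLocal L 3 (Matrix.diagonal (α ∘ ⇑τ)) w)} : Set (archLocal L 3 (Matrix.diagonal (α ∘ ⇑τ)) w))))
        (hνH : ∀ w τ, (νH w τ).IsHaarMeasure ∧ (νH w τ).IsInvInvariant)
        (hpin : ∀ (w : {w : InfinitePlace L // IsComplex w}) (τ : Perm (Fin 3)), (w.1.embedding (α (τ 0))).re * (w.1.embedding (α (τ 2))).re < 0 →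
        haveI : LocallyCompactSpace (archLocal L 3 (Matrix.diagonal (α ∘ ⇑τ)) w) := locallyCompactSpace_archLocal L 3 (Matrix.diagonal (α ∘ ⇑τ)) w
        haveI : SecondCountableTopology (archLocal L 3 (Matrix.diagonal (α ∘ ⇑τ)) w) := secondCountableTopology_archLocal L 3 (Matrix.diagonal (α ∘ ⇑τ)) w
        haveI : (νH w τ).IsHaarMeasure := (hνH w τ).1
        haveI : (νH w τ).IsInvInvariant := (hνH w τ).2
        ∃ (ν : Measure (archLocal L 3 (Matrix.diagonal (α ∘ ⇑τ)) w)) (_ : ν.IsHaarMeasure) (_ : ν.IsMulRightInvariant),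
          ∀ (Θ : Matrix (Fin 3) (Fin 3) ℂ → ℂ), ContDiff ℝ (⊤ : ℕ∞) Θ →
            HasCompactSupport (fun k : archLocal L 3 (Matrix.diagonal (α ∘ ⇑τ)) w => Θ ((k : GL (Fin 3) ℂ) : Matrix (Fin 3) (Fin 3) ℂ)) →
            ∀ (z₀ : Fin 3 → Circle) (h02' : z₀ 0 = z₀ 2) (h01' : z₀ 0 ≠ z₀ 1),
              Tendsto (fun ψ : ℝ => deriv (fun ψ : ℝ => (2 * Real.sin ψ : ℂ) *
                  ∫ g, Θ (((g * ⟨circleDiagonal 3 (fun i => z₀ i * Circle.exp (![(1 : ℝ), 0, -1] i * ψ)),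
                    circleDiagonal_mem_archLocal_diagonal L 3 (α ∘ ⇑τ) w _⟩ * g⁻¹ : archLocal L 3 (Matrix.diagonal (α ∘ ⇑τ)) w) : GL (Fin 3) ℂ) : Matrix (Fin 3) (Fin 3) ℂ) ∂(ν)) ψ)
                (𝓝[≠] 0)
                (𝓝 ((-1 : ℂ) * ∫ y, descConj (⟨circleDiagonal 3 z₀, circleDiagonal_mem_archLocal_diagonal L 3 (α ∘ ⇑τ) w z₀⟩ : archLocal L 3 (Matrix.diagonal (α ∘ ⇑τ)) w)
                  (Subgroup.centralizer ({(⟨circleDiagonal 3 (z₁ w), circleDiagonal_mem_archLocal_diagonal L 3 (α ∘ ⇑τ) w (z₁ w)⟩ : archLocal L 3 (Matrix.diagonal (α ∘ ⇑τ)) w)} : Set (archLocal L 3 (Matrix.diagonal (α ∘ ⇑τ)) w)))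
                  (forall_mem_centralizer_circleDiagonal_comm_of_wall L (α ∘ ⇑τ) w (h02 w) (h01 w) h02' h01')
                  (fun k : archLocal L 3 (Matrix.diagonal (α ∘ ⇑τ)) w => Θ ((k : GL (Fin 3) ℂ) : Matrix (Fin 3) (Fin 3) ℂ)) y
                  ∂(quotientMeasure _ (νH w τ) (isClosed_coe_centralizer_singleton _) (ν))))),
      ∀ (z : {w : InfinitePlace L // IsComplex w} → Fin 3 → Circle) (hwall : ∀ w, z w 0 = z w 2 ∧ z w 0 ≠ z w 1)
        (_hrat : ∃ a b : L, ∀ w : {w : InfinitePlace L // IsComplex w}, ((z w 0 : ℂ) = w.1.embedding a) ∧ ((z w 1 : ℂ) = w.1.embedding b))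
        (ρ : {w : InfinitePlace L // IsComplex w} → Perm (Fin 3)) (w : {w : InfinitePlace L // IsComplex w}),
        ¬ 0 < (w.1.embedding (α ((ρ w)⁻¹ 0))).re * (w.1.embedding (α ((ρ w)⁻¹ 2))).re →
        ∀ (a b : L) (T : GL (Fin 3) (mixedSpace L)) (H_a : Matrix (Fin 2) (Fin 2) L) (H_b : Matrix (Fin 1) (Fin 1) L)
          (hf : IsSingularArchFrame L (Matrix.diagonal α) (archDiagTorus L 3 α (fun w => z w ∘ ⇑(ρ w))) a b T H_a H_b),
          ((μ2 H_a w).prod (μ1 H_b w)).map (fun u : archLocal L 2 H_a w × archLocal L 1 H_b w =>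
            (⟨⟨Matrix.GeneralLinearGroup.map (evalC L w) T *
                ((blockDiagFin (starRingEnd ℂ) (H_a.map w.1.embedding) (H_b.map w.1.embedding) u : unitaryGroupOfForm (starRingEnd ℂ) (finSum 2 1 (H_a.map w.1.embedding) (H_b.map w.1.embedding))) : GL (Fin (2 + 1)) ℂ) *
                (Matrix.GeneralLinearGroup.map (evalC L w) T)⁻¹, conj_blockDiagFin_mem_archLocal L w (formCongr_map_evalC_of_formCongr_archFormOf L hf.formCongr_eq w) u⟩,
              conj_blockDiagFin_mem_centralizer L w (formCongr_map_evalC_of_formCongr_archFormOf L hf.formCongr_eq w) (⟨circleDiagonal 3 (z w ∘ ⇑(ρ w)), circleDiagonal_mem_archLocal_diagonal L 3 α w (z w ∘ ⇑(ρ w))⟩ : archLocal L 3 (Matrix.diagonal α) w)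
                (by rw [coe_eq_map_evalC_of_archPiEquivCM_symm_eq L (archPiEquivCM_symm_circleDiagonal_eq_archDiagTorus L 3 α (fun w => z w ∘ ⇑(ρ w))) w]; exact mul_eq_map_evalC_of_mul_eq L hf.mul_eq w) u⟩ :
              Subgroup.centralizer ({(⟨circleDiagonal 3 (z w ∘ ⇑(ρ w)), circleDiagonal_mem_archLocal_diagonal L 3 α w (z w ∘ ⇑(ρ w))⟩ : archLocal L 3 (Matrix.diagonal α) w)} : Set (archLocal L 3 (Matrix.diagonal α) w)))) =
          M • (νH w (ρ w)⁻¹).map (subgroupCongrHomeomorph (ContinuousMulEquiv.restrictSubgroup (GLn.conjEquiv (Matrix.GeneralLinearGroup.mkOfDetNeZero _ (det_monomial_one_ne_zero 3 (ρ w)⁻¹))) (archLocal L 3 (Matrix.diagonal (α ∘ ⇑(ρ w)⁻¹)) w) (archLocal L 3 (Matrix.diagonal α) w) (mem_archLocal_comp_perm_iff_conj_mem L 3 α w (ρ w)⁻¹)).toMulEquiv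
        (Subgroup.centralizer ({(⟨circleDiagonal 3 (z₁ w), circleDiagonal_mem_archLocal_diagonal L 3 (α ∘ ⇑(ρ w)⁻¹) w (z₁ w)⟩ : archLocal L 3 (Matrix.diagonal (α ∘ ⇑(ρ w)⁻¹)) w)} : Set (archLocal L 3 (Matrix.diagonal (α ∘ ⇑(ρ w)⁻¹)) w)))
        (Subgroup.centralizer ({(⟨circleDiagonal 3 (z w ∘ ⇑(ρ w)), circleDiagonal_mem_archLocal_diagonal L 3 α w (z w ∘ ⇑(ρ w))⟩ : archLocal L 3 (Matrix.diagonal α) w)} : Set (archLocal L 3 (Matrix.diagonal α) w)))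
        (relabel_inv_mem_centralizer_circleDiagonal_comp_iff L α w (ρ w) (h02 w) (h01 w) (hwall w).1 (hwall w).2)
        (ContinuousMulEquiv.restrictSubgroup (GLn.conjEquiv (Matrix.GeneralLinearGroup.mkOfDetNeZero _ (det_monomial_one_ne_zero 3 (ρ w)⁻¹))) (archLocal L 3 (Matrix.diagonal (α ∘ ⇑(ρ w)⁻¹)) w) (archLocal L 3 (Matrix.diagonal α) w) (mem_archLocal_comp_perm_iff_conj_mem L 3 α w (ρ w)⁻¹)).continuous
        (ContinuousMulEquiv.restrictSubgroup (GLn.conjEquiv (Matrix.GeneralLinearGroup.mkOfDetNeZero _ (det_monomial_one_ne_zero 3 (ρ w)⁻¹))) (archLocal L 3 (Matrix.diagonal (α ∘ ⇑(ρ w)⁻¹)) w) (archLocal L 3 (Matrix.diagonal α) w) (mem_archLocal_comp_perm_iff_conj_mem L 3 α w (ρ w)⁻¹)).symm.continuous)) :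
    ∃ K : ℝ≥0, K ≠ 0 ∧
      ∀ (νH : ∀ (w : {w : InfinitePlace L // IsComplex w}) (τ : Perm (Fin 3)), Measure (Subgroup.centralizer ({(⟨circleDiagonal 3 (z₁ w), circleDiagonal_mem_archLocal_diagonal L 3 (α ∘ ⇑τ) w (z₁ w)⟩ : archLocal L 3 (Matrix.diagonal (α ∘ ⇑τ)) w)} : Set (archLocal L 3 (Matrix.diagonal (α ∘ ⇑τ)) w))))
        (hνH : ∀ w τ, (νH w τ).IsHaarMeasure ∧ (νH w τ).IsInvInvariant)
        (hpin : ∀ (w : {w : InfinitePlace L // IsComplex w}) (τ : Perm (Fin 3)), (w.1.embedding (α (τ 0))).re * (w.1.embedding (α (τ 2))).re < 0 →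
        haveI : LocallyCompactSpace (archLocal L 3 (Matrix.diagonal (α ∘ ⇑τ)) w) := locallyCompactSpace_archLocal L 3 (Matrix.diagonal (α ∘ ⇑τ)) w
        haveI : SecondCountableTopology (archLocal L 3 (Matrix.diagonal (α ∘ ⇑τ)) w) := secondCountableTopology_archLocal L 3 (Matrix.diagonal (α ∘ ⇑τ)) w
        haveI : (νH w τ).IsHaarMeasure := (hνH w τ).1
        haveI : (νH w τ).IsInvInvariant := (hνH w τ).2
        ∃ (ν : Measure (archLocal L 3 (Matrix.diagonal (α ∘ ⇑τ)) w)) (_ : ν.IsHaarMeasure) (_ : ν.IsMulRightInvariant),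
          ∀ (Θ : Matrix (Fin 3) (Fin 3) ℂ → ℂ), ContDiff ℝ (⊤ : ℕ∞) Θ →
            HasCompactSupport (fun k : archLocal L 3 (Matrix.diagonal (α ∘ ⇑τ)) w => Θ ((k : GL (Fin 3) ℂ) : Matrix (Fin 3) (Fin 3) ℂ)) →
            ∀ (z₀ : Fin 3 → Circle) (h02' : z₀ 0 = z₀ 2) (h01' : z₀ 0 ≠ z₀ 1),
              Tendsto (fun ψ : ℝ => deriv (fun ψ : ℝ => (2 * Real.sin ψ : ℂ) *
                  ∫ g, Θ (((g * ⟨circleDiagonal 3 (fun i => z₀ i * Circle.exp (![(1 : ℝ), 0, -1] i * ψ)),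
                    circleDiagonal_mem_archLocal_diagonal L 3 (α ∘ ⇑τ) w _⟩ * g⁻¹ : archLocal L 3 (Matrix.diagonal (α ∘ ⇑τ)) w) : GL (Fin 3) ℂ) : Matrix (Fin 3) (Fin 3) ℂ) ∂(ν)) ψ)
                (𝓝[≠] 0)
                (𝓝 ((-1 : ℂ) * ∫ y, descConj (⟨circleDiagonal 3 z₀, circleDiagonal_mem_archLocal_diagonal L 3 (α ∘ ⇑τ) w z₀⟩ : archLocal L 3 (Matrix.diagonal (α ∘ ⇑τ)) w)
                  (Subgroup.centralizer ({(⟨circleDiagonal 3 (z₁ w), circleDiagonal_mem_archLocal_diagonal L 3 (α ∘ ⇑τ) w (z₁ w)⟩ : archLocal L 3 (Matrix.diagonal (α ∘ ⇑τ)) w)} : Set (archLocal L 3 (Matrix.diagonal (α ∘ ⇑τ)) w)))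
                  (forall_mem_centralizer_circleDiagonal_comm_of_wall L (α ∘ ⇑τ) w (h02 w) (h01 w) h02' h01')
                  (fun k : archLocal L 3 (Matrix.diagonal (α ∘ ⇑τ)) w => Θ ((k : GL (Fin 3) ℂ) : Matrix (Fin 3) (Fin 3) ℂ)) y
                  ∂(quotientMeasure _ (νH w τ) (isClosed_coe_centralizer_singleton _) (ν)))))
        (z : {w : InfinitePlace L // IsComplex w} → Fin 3 → Circle) (hwall : ∀ w, z w 0 = z w 2 ∧ z w 0 ≠ z w 1)
        (hrat : ∃ a b : L, ∀ w : {w : InfinitePlace L // IsComplex w}, ((z w 0 : ℂ) = w.1.embedding a) ∧ ((z w 1 : ℂ) = w.1.embedding b))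
        (ρ : {w : InfinitePlace L // IsComplex w} → Perm (Fin 3))
        (ρZ : ∀ (w : {w : InfinitePlace L // IsComplex w}) (σ : Perm (Fin 3)), Measure (Subgroup.centralizer ({(⟨circleDiagonal 3 (z w ∘ ⇑σ), circleDiagonal_mem_archLocal_diagonal L 3 α w (z w ∘ ⇑σ)⟩ : archLocal L 3 (Matrix.diagonal α) w)} : Set (archLocal L 3 (Matrix.diagonal α) w))))
        (hρZi : ∀ w σ, (ρZ w σ).IsHaarMeasure ∧ (ρZ w σ).IsInvInvariant)
        (hρZ : ∀ (w : {w : InfinitePlace L // IsComplex w}) (σ : Perm (Fin 3)), ¬ 0 < (w.1.embedding (α (σ⁻¹ 0))).re * (w.1.embedding (α (σ⁻¹ 2))).re →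
          ρZ w σ = (νH w σ⁻¹).map (subgroupCongrHomeomorph (ContinuousMulEquiv.restrictSubgroup (GLn.conjEquiv (Matrix.GeneralLinearGroup.mkOfDetNeZero _ (det_monomial_one_ne_zero 3 σ⁻¹))) (archLocal L 3 (Matrix.diagonal (α ∘ ⇑σ⁻¹)) w) (archLocal L 3 (Matrix.diagonal α) w) (mem_archLocal_comp_perm_iff_conj_mem L 3 α w σ⁻¹)).toMulEquiv
        (Subgroup.centralizer ({(⟨circleDiagonal 3 (z₁ w), circleDiagonal_mem_archLocal_diagonal L 3 (α ∘ ⇑σ⁻¹) w (z₁ w)⟩ : archLocal L 3 (Matrix.diagonal (α ∘ ⇑σ⁻¹)) w)} : Set (archLocal L 3 (Matrix.diagonal (α ∘ ⇑σ⁻¹)) w)))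
        (Subgroup.centralizer ({(⟨circleDiagonal 3 (z w ∘ ⇑σ), circleDiagonal_mem_archLocal_diagonal L 3 α w (z w ∘ ⇑σ)⟩ : archLocal L 3 (Matrix.diagonal α) w)} : Set (archLocal L 3 (Matrix.diagonal α) w)))
        (relabel_inv_mem_centralizer_circleDiagonal_comp_iff L α w σ (h02 w) (h01 w) (hwall w).1 (hwall w).2)
        (ContinuousMulEquiv.restrictSubgroup (GLn.conjEquiv (Matrix.GeneralLinearGroup.mkOfDetNeZero _ (det_monomial_one_ne_zero 3 σ⁻¹))) (archLocal L 3 (Matrix.diagonal (α ∘ ⇑σ⁻¹)) w) (archLocal L 3 (Matrix.diagonal α) w) (mem_archLocal_comp_perm_iff_conj_mem L 3 α w σ⁻¹)).continuous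
        (ContinuousMulEquiv.restrictSubgroup (GLn.conjEquiv (Matrix.GeneralLinearGroup.mkOfDetNeZero _ (det_monomial_one_ne_zero 3 σ⁻¹))) (archLocal L 3 (Matrix.diagonal (α ∘ ⇑σ⁻¹)) w) (archLocal L 3 (Matrix.diagonal α) w) (mem_archLocal_comp_perm_iff_conj_mem L 3 α w σ⁻¹)).symm.continuous))
        (hρZ1 : ∀ (w : {w : InfinitePlace L // IsComplex w}) (σ : Perm (Fin 3)), 0 < (w.1.embedding (α (σ⁻¹ 0))).re * (w.1.embedding (α (σ⁻¹ 2))).re → ρZ w σ Set.univ = 1)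
        (ρP : Measure (Subgroup.pi Set.univ (fun w : {w : InfinitePlace L // IsComplex w} => Subgroup.centralizer ({(⟨circleDiagonal 3 (z w ∘ ⇑(ρ w)), circleDiagonal_mem_archLocal_diagonal L 3 α w (z w ∘ ⇑(ρ w))⟩ : archLocal L 3 (Matrix.diagonal α) w)} : Set (archLocal L 3 (Matrix.diagonal α) w)))))
        (hρP : Measure.map (subgroupPiCoords fun w : {w : InfinitePlace L // IsComplex w} => Subgroup.centralizer ({(⟨circleDiagonal 3 (z w ∘ ⇑(ρ w)), circleDiagonal_mem_archLocal_diagonal L 3 α w (z w ∘ ⇑(ρ w))⟩ : archLocal L 3 (Matrix.diagonal α) w)} : Set (archLocal L 3 (Matrix.diagonal α) w))) ρP = Measure.pi fun w => ρZ w (ρ w))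
        (ρ' : Measure (Subgroup.centralizer ({archDiagTorus L 3 α (fun w => z w ∘ ⇑(ρ w))} : Set (arch (↥(maximalRealSubfield L)) L (IsCMField.complexConj L) 3 (Matrix.diagonal α)))))
        (hρ' : ρ' = ρP.map (subgroupCongrHomeomorph (archPiEquivCM 3 L (Matrix.diagonal α)).symm.toMulEquiv (Subgroup.pi Set.univ (fun w : {w : InfinitePlace L // IsComplex w} => Subgroup.centralizer ({(⟨circleDiagonal 3 (z w ∘ ⇑(ρ w)), circleDiagonal_mem_archLocal_diagonal L 3 α w (z w ∘ ⇑(ρ w))⟩ : archLocal L 3 (Matrix.diagonal α) w)} : Set (archLocal L 3 (Matrix.diagonal α) w)))) (Subgroup.centralizer ({archDiagTorus L 3 α (fun w => z w ∘ ⇑(ρ w))} : Set (arch (↥(maximalRealSubfield L)) L (IsCMField.complexConj L) 3 (Matrix.diagonal α)))) (apply_mem_centralizer_iff_mem_pi_centralizer _ (archPiEquivCM 3 L (Matrix.diagonal α)).symm.toMulEquiv (archPiEquivCM_symm_circleDiagonal_eq_archDiagTorus L 3 α (fun w => z w ∘ ⇑(ρ w)))) (archPiEquivCM 3 L (Matrix.diagonal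 α)).symm.continuous (archPiEquivCM 3 L (Matrix.diagonal α)).continuous)),
        centralizerTopFormHaar L (Matrix.diagonal α) (archDiagTorus L 3 α (fun w => z w ∘ ⇑(ρ w))) = K • ρ' := by
  classical
  refine ⟨M ^ Fintype.card {w : InfinitePlace L // IsComplex w}, pow_ne_zero _ hM, ?_⟩
  intro νH hνH hpin z hwall hrat ρ ρZ hρZi hρZ hρZ1 ρP hρP ρ' hρ'
  -- a frame of `t(z∘ρ)` (★ (b5))
  obtain ⟨a, b, T, H_a, H_b, hf⟩ := exists_isSingularArchFrame_archDiagTorus_wall' L α hα hherm z hwall hrat ρ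
  -- Borel structures on the blocks and their Lie algebras (those of ★ `centralizerTopFormHaar`'s definition)
  letI iA2 : MeasurableSpace (arch (↥(maximalRealSubfield L)) L (IsCMField.complexConj L) 2 H_a) := borel _
  haveI iB2 : BorelSpace (arch (↥(maximalRealSubfield L)) L (IsCMField.complexConj L) 2 H_a) := ⟨rfl⟩
  letI iS2 : MeasurableSpace (archSkew (↥(maximalRealSubfield L)) L (IsCMField.complexConj L) 2 H_a) := borel _
  haveI iT2 : BorelSpace (archSkew (↥(maximalRealSubfield L)) L (IsCMField.complexConj L) 2 H_a) := ⟨rfl⟩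
  letI iA1 : MeasurableSpace (arch (↥(maximalRealSubfield L)) L (IsCMField.complexConj L) 1 H_b) := borel _
  haveI iB1 : BorelSpace (arch (↥(maximalRealSubfield L)) L (IsCMField.complexConj L) 1 H_b) := ⟨rfl⟩
  letI iS1 : MeasurableSpace (archSkew (↥(maximalRealSubfield L)) L (IsCMField.complexConj L) 1 H_b) := borel _
  haveI iT1 : BorelSpace (archSkew (↥(maximalRealSubfield L)) L (IsCMField.complexConj L) 1 H_b) := ⟨rfl⟩
  -- topology of the local groups
  haveI : ∀ w : {w : InfinitePlace L // IsComplex w}, SecondCountableTopology (archLocal L 2 H_a w) := fun w => secondCountableTopology_archLocal L 2 H_a w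
  haveI : ∀ w : {w : InfinitePlace L // IsComplex w}, SecondCountableTopology (archLocal L 1 H_b w) := fun w => secondCountableTopology_archLocal L 1 H_b w
  haveI : ∀ w : {w : InfinitePlace L // IsComplex w}, SecondCountableTopology (archLocal L 3 (Matrix.diagonal α) w) := fun w =>
    secondCountableTopology_archLocal L 3 (Matrix.diagonal α) w
  haveI : ∀ w : {w : InfinitePlace L // IsComplex w}, LocallyCompactSpace (archLocal L 3 (Matrix.diagonal α) w) := fun w => locallyCompactSpace_archLocal L 3 (Matrix.diagonal α) w
  haveI hZlc : ∀ w : {w : InfinitePlace L // IsComplex w}, LocallyCompactSpace (Subgroup.centralizer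
      ({(⟨circleDiagonal 3 (z w ∘ ⇑(ρ w)), circleDiagonal_mem_archLocal_diagonal L 3 α w (z w ∘ ⇑(ρ w))⟩ : archLocal L 3 (Matrix.diagonal α) w)} : Set (archLocal L 3 (Matrix.diagonal α) w))) :=
    fun w => (isClosed_coe_centralizer_singleton _).isClosedEmbedding_subtypeVal.locallyCompactSpace
  haveI hZh : ∀ w : {w : InfinitePlace L // IsComplex w}, (ρZ w (ρ w)).IsHaarMeasure := fun w => (hρZi w (ρ w)).1
  -- (U2): the block top-form measures are transported products
  have e2 : archTopFormHaar (↥(maximalRealSubfield L)) L (IsCMField.complexConj L) 2 H_a = (Measure.pi (μ2 H_a)).map (archPiEquivCM 2 L H_a).symm :=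
    eq_map_of_map_eq (archPiEquivCM 2 L H_a).continuous.measurable (archPiEquivCM 2 L H_a).symm.continuous.measurable
      (fun x => (archPiEquivCM 2 L H_a).symm_apply_apply x) (hfac2 H_a hf.2.1 hf.2.2.2.1)
  have e1 : archTopFormHaar (↥(maximalRealSubfield L)) L (IsCMField.complexConj L) 1 H_b = (Measure.pi (μ1 H_b)).map (archPiEquivCM 1 L H_b).symm :=
    eq_map_of_map_eq (archPiEquivCM 1 L H_b).continuous.measurable (archPiEquivCM 1 L H_b).symm.continuous.measurable
      (fun x => (archPiEquivCM 1 L H_b).symm_apply_apply x) (hfac1 H_b hf.2.2.1 hf.2.2.2.2.1)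
  -- the measure `ρP` IS the transported product `⊗_w ρZ_{w, ρ_w}`
  have eP : ρP = (Measure.pi fun w : {w : InfinitePlace L // IsComplex w} => ρZ w (ρ w)).map
      (subgroupPiCoords fun w : {w : InfinitePlace L // IsComplex w} => Subgroup.centralizer
        ({(⟨circleDiagonal 3 (z w ∘ ⇑(ρ w)), circleDiagonal_mem_archLocal_diagonal L 3 α w (z w ∘ ⇑(ρ w))⟩ : archLocal L 3 (Matrix.diagonal α) w)} : Set (archLocal L 3 (Matrix.diagonal α) w))).symm :=
    eq_map_of_map_eq
      (subgroupPiHomeomorph fun w : {w : InfinitePlace L // IsComplex w} => Subgroup.centralizer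
        ({(⟨circleDiagonal 3 (z w ∘ ⇑(ρ w)), circleDiagonal_mem_archLocal_diagonal L 3 α w (z w ∘ ⇑(ρ w))⟩ : archLocal L 3 (Matrix.diagonal α) w)} : Set (archLocal L 3 (Matrix.diagonal α) w))).measurable
      (subgroupPiHomeomorph fun w : {w : InfinitePlace L // IsComplex w} => Subgroup.centralizer
        ({(⟨circleDiagonal 3 (z w ∘ ⇑(ρ w)), circleDiagonal_mem_archLocal_diagonal L 3 α w (z w ∘ ⇑(ρ w))⟩ : archLocal L 3 (Matrix.diagonal α) w)} : Set (archLocal L 3 (Matrix.diagonal α) w))).symm.measurable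
      (fun x => (subgroupPiCoords fun w : {w : InfinitePlace L // IsComplex w} => Subgroup.centralizer
        ({(⟨circleDiagonal 3 (z w ∘ ⇑(ρ w)), circleDiagonal_mem_archLocal_diagonal L 3 α w (z w ∘ ⇑(ρ w))⟩ : archLocal L 3 (Matrix.diagonal α) w)} : Set (archLocal L 3 (Matrix.diagonal α) w))).symm_apply_apply x)
      hρP
  -- the frame measure in product currency (★ U3), with local frame measures `θ_w := M • ρZ_{w, ρ_w}` — admissible by (HC) ∕ (HN), place by place
  rw [centralizerTopFormHaar_eq_centralizerMeasureOfFrame hf, e2, e1,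
    centralizerMeasureOfFrame_pi_eq_map_pi (N₁ := 2) (N₂ := 1) (J := Matrix.diagonal α) (J₁ := H_a) (J₂ := H_b) L T hf.formCongr_eq
      (archDiagTorus L 3 α fun w => z w ∘ ⇑(ρ w)) hf.mul_eq
      (fun w => (⟨circleDiagonal 3 (z w ∘ ⇑(ρ w)), circleDiagonal_mem_archLocal_diagonal L 3 α w (z w ∘ ⇑(ρ w))⟩ : archLocal L 3 (Matrix.diagonal α) w))
      (archPiEquivCM_symm_circleDiagonal_eq_archDiagTorus L 3 α fun w => z w ∘ ⇑(ρ w)) (μ2 H_a) (μ1 H_b) (fun w => M • ρZ w (ρ w)) ?hθ]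
  case hθ =>
    intro w
    by_cases hs : 0 < (w.1.embedding (α ((ρ w)⁻¹ 0))).re * (w.1.embedding (α ((ρ w)⁻¹ 2))).re
    · -- compact place: Haar uniqueness with masses `M` (HC) and `1` (`hρZ1`)
      obtain ⟨hH, hmass⟩ := hC z hwall hrat ρ w hs a b T H_a H_b hf
      haveI := hH
      exact (eq_smul_of_isHaarMeasure_of_measure_univ _ _ hmass (hρZ1 w (ρ w) hs)).symm
    · -- noncompact place: (HN) and the pinned clause `hρZ`
      refine ((hN νH hνH hpin z hwall hrat ρ w hs a b T H_a H_b hf).trans ?_).symm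
      rw [hρZ w (ρ w) hs]
  -- `⊗_w (M • ρZ_w) = M ^ #w • ⊗_w ρZ_w`, then the `ρP ∕ ρ′` currency
  rw [pi_const_smul (fun w : {w : InfinitePlace L // IsComplex w} => ρZ w (ρ w)) M, Measure.map_smul, Measure.map_smul, hρ', eP]

end Literature.NumberTheory.Rogawski1990

end
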